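import Literature.AlgebraicGeometry.ShimuraVarieties.UnitaryCurveAuxiliarySymplecticModule
import HarnessLib

/-!
# The `W₀`-FREE symplectic module `(V_M, ψ_V)` of the unitary datum in any rank `n`, and its similitude representation `(t, X) ↦ t·X`
# (RSZ 2020 Remark 3.2 (ii)(iii): `Sh(G̃) → Sh(GU(V)) → 𝒜_g`; Deligne 1979 Prop. 2.3.10 without the auxiliary line)

Topic `AlgebraicGeometry/ShimuraVarieties`; namespace `Literature.AlgebraicGeometry.ShimuraVarieties.UnitaryCurve.AuxV`.
Definitions with bodies and theorems; no named fact, no instance, nothing asserted (net debt 0).  Cell `hodgecm-mathlib` (D-0151),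
FLOOR 0, P6 «MOD programme», door (E) of `stub_RGD`, organ **E1 FILE 1b** — the shape asked by the E-LINE chart `AuxChartGS` of the GEN integrator
A-p18 (g31) (bus 2026-09-01 21:28:48Z (2)): the Siegel target of the point map is `GSp(V_M∣_ℚ, ψ_V)` with
`ψ_V = Tr_{M∕ℚ}(ξ·ᵗc(x)·H^j·y)` — the `Fin n` BLOCK of ★ `UnitaryCurve.Aux.auxGram = diag(ξ₀, ξ·H^j)` — of dimension `2g = n·[M:ℚ]`
(`g = [F:ℚ]` at `n = 2`, `M = F`), the auxiliary torus `T₀(M) = Z^ℚ` acting by SCALARS (similitude factor `Nm t ∈ ℚ`): the composite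
`{a₀} × M_{Kc} ⊂ Sh(G̃) → Sh(GU(V)) → 𝒜_g` of [RapoportSmithlingZhang2020Diagonal] Remark 3.2 (ii)(iii) and (3.3) `G̃ ≅ Z^ℚ × U(V)`.  This hands
the dock a universal abelian scheme of relative dimension `[F:ℚ]` (no `A₀ × A` splitting).  The `W₀ ⊕ V_M` files (★ `UnitaryCurveAuxiliarySymplectic{Module,
Adelic,Level}`) stay as capital for an `A₀`-road and for rank-3 compatibility.  `--supports stmt-HodgeConjecture-24832`, count-neutral; HC_CM is proved only
modulo the printed citations until rung 0 closes.

* §1 `auxGramV M j H ξ = ξ • H^j` on `V_M = M^n`, `auxGramVR`, the form `auxFormV = Tr_{M∕ℚ}(ᵗc(x)·auxGramV·y)` (★ `traceForm`).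
* §2 `blockGLV S : Sˣ × GL_n(S) →* GL_n(S)`, `(t, X) ↦ t·X`, `coe_blockGLV`, `transpose_map_coe_blockGLV`, and the form condition `block_formV`:
  `c(t)·t = ν`, `ᵗc(X)·H·X = H` ⇒ `ᵗc(tX)·(ξH)·(tX) = ν·(ξH)`.
* §3 `SymplecticFrameV M j H ξ g δ` — a symplectic `ℚ`-basis of type `δ`: `β : M^n ≃ₗ[ℚ] ℚ^{g ⊕ g}` with `auxFormV v w = β(v)·E_δ·β(w)`;
  `framePV ∕ frameQV` (`P Q = 1`, `Q P = 1`), `framePV_apply`, `framePVR ∕ frameQVR`.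
* §4 **`auxRepV R F : (R ⊗_ℚ M)ˣ × GL_n(R ⊗_ℚ M) →* GL_{g⊕g}(R)`** (scalars times `X`, restriction of scalars along `1 ⊗ b_k`, read in the frame),
  `traceGramV_baseChange`, `traceGramV_eq_frame`, `traceGramV_baseChange_eq_frame`, **`isMultiplier_auxRepV`** (multiplier `ν = c(t)·t`) and
  **`auxRepV_mem_similitudeGroupOfForm`**.

## References
* [RapoportSmithlingZhang2020Diagonal] M. Rapoport, B. Smithling, W. Zhang, *Arithmetic diagonal cycles on unitary Shimura varieties*, Compos. Math. 156
  (2020), Remark 3.2 (ii)(iii) pp. 9–10, (3.3), Prop. 3.7 pp. 13–14.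
* [Deligne1979ShimuraVarieties] P. Deligne, *Variétés de Shimura* (1979), Prop. 2.3.10 (PDF p. 32 of Milne's translation).
* [Milne2005ShimuraVarieties] J. S. Milne, *Introduction to Shimura varieties* (2005), §6 p. 67, §8 p. 81 («ψ = Tr_{B/ℚ}»), Thm. 8.17 p. 88.
* [Kottwitz1992] R. Kottwitz, *Points on some Shimura varieties over finite fields*, JAMS 5 (1992), §5 p. 390 (the PEL datum of `GU`).
-/

set_option autoImplicit false

noncomputable section

open Matrix NumberField
open scoped TensorProduct

namespace Literature.AlgebraicGeometry.ShimuraVarieties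

namespace UnitaryCurve

namespace AuxV

open Literature.AlgebraicGeometry.ModuliOfAbelianVarieties
open Literature.AlgebraicGeometry.ShimuraVarieties.UnitaryCanonicalModel.Aux (conjAlgHom conjAlgHom_apply conjR conjR_tmul ratBasis
  trace_one_tmul)

/-! ### §1. The Gram data `ξ·H^j` on `V_M = M^n` and the trace form `ψ_V` -/

section Gram

variable {L : Type} [Field L] (M : Type) [Field M] [NumberField M] [IsCMField M] (j : L →+* M)
  {n : ℕ} (H : Matrix (Fin n) (Fin n) L) (ξ : M)

/-- **The sesquilinear Gram matrix `ξ·H^j` on `V_M = M^n`** (`H^j = H.map j`, the hermitian form extended `M`-sesquilinearly) — the `V`-block of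
★ `UnitaryCurve.Aux.auxGram`. [cite: RapoportSmithlingZhang2020Diagonal, Remark 3.2 (ii)(iii) pp. 9–10] [cite: Milne2005ShimuraVarieties, §8 p. 81] -/
def auxGramV : Matrix (Fin n) (Fin n) M :=
  ξ • H.map j

/-- `auxGramV` base-changed to `R ⊗_ℚ M` (entries `1 ⊗ G_{ij}`). [cite: Milne2005ShimuraVarieties, §8 p. 81] -/
def auxGramVR (R : Type) [CommRing R] [Algebra ℚ R] : Matrix (Fin n) (Fin n) (R ⊗[ℚ] M) :=
  (auxGramV M j H ξ).map (Algebra.TensorProduct.includeRight : M →ₐ[ℚ] R ⊗[ℚ] M)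

omit [IsCMField M] in
/-- Entries of `auxGramVR`: `1 ⊗ G_{ij}`. [cite: Milne2005ShimuraVarieties, §8 p. 81] -/
@[simp] theorem auxGramVR_apply (R : Type) [CommRing R] [Algebra ℚ R] (i i' : Fin n) :
    auxGramVR M j H ξ R i i' = (1 : R) ⊗ₜ auxGramV M j H ξ i i' := rfl

/-- **The symplectic form `ψ_V(x, y) = Tr_{M/ℚ}(ξ·ᵗc(x)·H^j·y)`** on `V_M`, as the trace form of `auxGramV` (★ `traceForm` at `R = ℚ`, `S = M`).
[cite: Milne2005ShimuraVarieties, §8 p. 81] [cite: RapoportSmithlingZhang2020Diagonal, Remark 3.2 (ii)(iii) pp. 9–10] -/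
def auxFormV : LinearMap.BilinForm ℚ (Fin n → M) :=
  traceForm (R := ℚ) (S := M) (conjAlgHom M) (auxGramV M j H ξ)

/-- Unfolding of `auxFormV`. [cite: Milne2005ShimuraVarieties, §8 p. 81] -/
theorem auxFormV_apply (v w : Fin n → M) :
    auxFormV M j H ξ v w = Algebra.trace ℚ M (dotProduct (fun i => IsCMField.complexConj M (v i)) (auxGramV M j H ξ *ᵥ w)) := rfl

end Gram

/-! ### §2. The scalar-times-matrix embedding `(t, X) ↦ t·X` and the form condition -/

section Block

variable (S : Type) [CommRing S] {n : ℕ}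

/-- A multiplicative map pulls a scalar out of an entrywise map: `(r·A).map f = f(r)·A.map f`. [cite: Milne2005ShimuraVarieties, §8 p. 81] -/
private theorem map_smul_eq {S' : Type} [CommRing S'] {m m' : Type} (f : S → S') (hf : ∀ a b, f (a * b) = f a * f b)
    (r : S) (A : Matrix m m' S) : (r • A).map f = f r • A.map f := by
  ext i k
  simp [hf]

/-- **`(t, X) ↦ t·X : Sˣ × GL_n(S) → GL_n(S)`** — the auxiliary torus acting by scalars on `V_M` ([RapoportSmithlingZhang2020Diagonal] (3.3): `(z, g) ↦ z·g`,
`G̃ ≅ Z^ℚ × U(V) → GU(V)`). [cite: RapoportSmithlingZhang2020Diagonal, Remark 3.2 (ii)(iii) pp. 9–10] -/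
def blockGLV : Sˣ × GL (Fin n) S →* GL (Fin n) S where
  toFun p :=
    { val := (p.1 : S) • (p.2 : Matrix (Fin n) (Fin n) S)
      inv := ((p.1⁻¹ : Sˣ) : S) • ((p.2⁻¹ : GL (Fin n) S) : Matrix (Fin n) (Fin n) S)
      val_inv := by simp [smul_smul]
      inv_val := by simp [smul_smul] }
  map_one' := by
    ext1
    simp only [Prod.fst_one, Prod.snd_one, Units.val_one, one_smul]
  map_mul' p q := by
    ext1
    change ((p.1 * q.1 : Sˣ) : S) • ((p.2 * q.2 : GL (Fin n) S) : Matrix (Fin n) (Fin n) S) =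
      (p.1 : S) • (p.2 : Matrix (Fin n) (Fin n) S) * ((q.1 : S) • (q.2 : Matrix (Fin n) (Fin n) S))
    simp [smul_smul, mul_comm (q.1 : S) (p.1 : S)]

/-- Underlying matrix of `blockGLV`. [cite: RapoportSmithlingZhang2020Diagonal, Remark 3.2 (ii)(iii) pp. 9–10] -/
@[simp] theorem coe_blockGLV (t : Sˣ) (X : GL (Fin n) S) :
    ((blockGLV S (t, X) : GL (Fin n) S) : Matrix (Fin n) (Fin n) S) = (t : S) • (X : Matrix (Fin n) (Fin n) S) := rfl

/-- `ᵗc(t·X) = c(t)·ᵗc(X)`. [cite: Milne2005ShimuraVarieties, §8 p. 81] -/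
theorem transpose_map_coe_blockGLV {S' : Type} [CommRing S'] (f : S →+* S') (t : Sˣ) (X : GL (Fin n) S) :
    ((((blockGLV S (t, X) : GL (Fin n) S) : Matrix (Fin n) (Fin n) S).map f)ᵀ) = f t • ((X : Matrix (Fin n) (Fin n) S).map f)ᵀ := by
  rw [coe_blockGLV, map_smul_eq S f (map_mul f), Matrix.transpose_smul]

/-- **The form condition for `t·X`**: if `c(t)·t = ν` (similitude torus) and `ᵗc(X)·H·X = H` (`X` unitary for `H`, the tree's ★ `unitaryGroupOfForm` convention)
then `A = t·X` satisfies `ᵗc(A)·(ξ·H)·A = ν·(ξ·H)`. [cite: RapoportSmithlingZhang2020Diagonal, Remark 3.2 (ii)(iii) pp. 9–10] [cite: Milne2005ShimuraVarieties, §8 p. 81] -/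
theorem block_formV {R : Type} [CommRing R] [Algebra R S] (c : S →ₐ[R] S) (Hs : Matrix (Fin n) (Fin n) S) (ξs : S) {t : Sˣ} {X : GL (Fin n) S}
    {ν : R} (ht : c (t : S) * (t : S) = algebraMap R S ν) (hX : ((X : Matrix (Fin n) (Fin n) S).map c)ᵀ * Hs * (X : Matrix (Fin n) (Fin n) S) = Hs) :
    (((blockGLV S (t, X) : GL (Fin n) S) : Matrix (Fin n) (Fin n) S).map c)ᵀ * (ξs • Hs) * ((blockGLV S (t, X) : GL (Fin n) S) : Matrix (Fin n) (Fin n) S) =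
      algebraMap R S ν • (ξs • Hs) := by
  have hT := transpose_map_coe_blockGLV S (c : S →+* S) t X
  simp only [RingHom.coe_coe] at hT
  rw [hT, coe_blockGLV]
  simp only [Matrix.smul_mul, Matrix.mul_smul, smul_smul]
  rw [hX, ← ht]
  congr 1
  ring

end Block

/-! ### §3. Symplectic frames of type `δ` for `(V_M, ψ_V)` -/

section Frame

variable {L : Type} [Field L] (M : Type) [Field M] [NumberField M] [IsCMField M] (j : L →+* M)
  {n : ℕ} (H : Matrix (Fin n) (Fin n) L) (ξ : M) (g : ℕ) (δ : Fin g → ℕ)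

/-- **A symplectic frame of type `δ` for `(V_M, ψ_V)`**: a `ℚ`-linear isomorphism `β : M^n ≃ ℚ^{g⊕g}` carrying `ψ_V` to the standard alternating form `E_δ`
of type `δ` (★ `typeFormOver δ ℚ`); the lattice of the moduli problem is `β⁻¹(ℤ^{2g})` (`2g = n·[M:ℚ]` is forced by the existence of `β`; `g = [F:ℚ]` for the curve).
[cite: Milne2005ShimuraVarieties, §6 p. 67] [cite: RapoportSmithlingZhang2020Diagonal, Remark 3.2 (ii)(iii) pp. 9–10] -/
structure SymplecticFrameV where
  /-- the symplectic coordinates. -/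
  β : (Fin n → M) ≃ₗ[ℚ] (Fin g ⊕ Fin g → ℚ)
  /-- `ψ_V(v, w) = ᵗβ(v)·E_δ·β(w)`. -/
  gram : ∀ v w, auxFormV M j H ξ v w = β v ⬝ᵥ (typeFormOver δ ℚ *ᵥ β w)

variable {M j H ξ g δ}

/-- The frame matrix `P`: columns = symplectic coordinates of the `M`-adapted basis vectors `eᵢ b_k`. [cite: Milne2005ShimuraVarieties, §6 p. 67] -/
def framePV (F : SymplecticFrameV M j H ξ g δ) : Matrix (Fin g ⊕ Fin g) (Fin n × Fin (Module.finrank ℚ M)) ℚ :=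
  LinearMap.toMatrix (resBasis (m := Fin n) (ratBasis M)) (Pi.basisFun ℚ (Fin g ⊕ Fin g)) F.β.toLinearMap

/-- The inverse frame matrix `Q`. [cite: Milne2005ShimuraVarieties, §6 p. 67] -/
def frameQV (F : SymplecticFrameV M j H ξ g δ) : Matrix (Fin n × Fin (Module.finrank ℚ M)) (Fin g ⊕ Fin g) ℚ :=
  LinearMap.toMatrix (Pi.basisFun ℚ (Fin g ⊕ Fin g)) (resBasis (m := Fin n) (ratBasis M)) F.β.symm.toLinearMap

/-- `P Q = 1`. [cite: Milne2005ShimuraVarieties, §6 p. 67] -/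
theorem framePV_mul_frameQV (F : SymplecticFrameV M j H ξ g δ) : framePV F * frameQV F = 1 := by
  rw [framePV, frameQV, ← LinearMap.toMatrix_comp]
  have h : F.β.toLinearMap ∘ₗ F.β.symm.toLinearMap = LinearMap.id := LinearMap.ext fun x => F.β.apply_symm_apply x
  rw [h, LinearMap.toMatrix_id]

/-- `Q P = 1`. [cite: Milne2005ShimuraVarieties, §6 p. 67] -/
theorem frameQV_mul_framePV (F : SymplecticFrameV M j H ξ g δ) : frameQV F * framePV F = 1 := by
  rw [framePV, frameQV, ← LinearMap.toMatrix_comp]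
  have h : F.β.symm.toLinearMap ∘ₗ F.β.toLinearMap = LinearMap.id := LinearMap.ext fun x => F.β.symm_apply_apply x
  rw [h, LinearMap.toMatrix_id]

/-- Entries of `P`: `P a (i,k) = β(eᵢ b_k) a`. [cite: Milne2005ShimuraVarieties, §6 p. 67] -/
theorem framePV_apply (F : SymplecticFrameV M j H ξ g δ) (a : Fin g ⊕ Fin g) (p : Fin n × Fin (Module.finrank ℚ M)) :
    framePV F a p = F.β (resBasis (m := Fin n) (ratBasis M) p) a := by
  rw [framePV, LinearMap.toMatrix_apply, Pi.basisFun_repr]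
  rfl

variable (R : Type) [CommRing R] [Algebra ℚ R]

/-- `P` over `R`. [cite: Milne2005ShimuraVarieties, §6 p. 67] -/
def framePVR (F : SymplecticFrameV M j H ξ g δ) : Matrix (Fin g ⊕ Fin g) (Fin n × Fin (Module.finrank ℚ M)) R :=
  (framePV F).map (algebraMap ℚ R)

/-- `Q` over `R`. [cite: Milne2005ShimuraVarieties, §6 p. 67] -/
def frameQVR (F : SymplecticFrameV M j H ξ g δ) : Matrix (Fin n × Fin (Module.finrank ℚ M)) (Fin g ⊕ Fin g) R :=
  (frameQV F).map (algebraMap ℚ R)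

/-- `P_R Q_R = 1`. [cite: Milne2005ShimuraVarieties, §6 p. 67] -/
theorem framePVR_mul_frameQVR (F : SymplecticFrameV M j H ξ g δ) : framePVR R F * frameQVR R F = 1 := by
  rw [framePVR, frameQVR, ← Matrix.map_mul, framePV_mul_frameQV, Matrix.map_one _ (map_zero _) (map_one _)]

/-- `Q_R P_R = 1`. [cite: Milne2005ShimuraVarieties, §6 p. 67] -/
theorem frameQVR_mul_framePVR (F : SymplecticFrameV M j H ξ g δ) : frameQVR R F * framePVR R F = 1 := by
  rw [framePVR, frameQVR, ← Matrix.map_mul, frameQV_mul_framePV, Matrix.map_one _ (map_zero _) (map_one _)]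

/-! ### §4. The similitude representation on `R`-points and its multiplier -/

/-- **The similitude representation on `R`-points `(R ⊗_ℚ M)ˣ × GL_n(R ⊗_ℚ M) → GL_{g⊕g}(R)`**: scalars times matrix `t·X`, restriction of scalars along the
`R`-basis `1 ⊗ b_k` of `R ⊗_ℚ M`, read in the symplectic frame — the `R`-points of `Z^ℚ × Res U(V) → GU(V_M∣_ℚ) ↪ GSp_δ`.
[cite: RapoportSmithlingZhang2020Diagonal, Remark 3.2 (ii)(iii) pp. 9–10] [cite: Milne2005ShimuraVarieties, §8 p. 81] -/
def auxRepV (F : SymplecticFrameV M j H ξ g δ) : (R ⊗[ℚ] M)ˣ × GL (Fin n) (R ⊗[ℚ] M) →* GL (Fin g ⊕ Fin g) R :=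
  (conjRect (framePVR R F) (frameQVR R F) (framePVR_mul_frameQVR R F) (frameQVR_mul_framePVR R F)).comp
    ((resGL (m := Fin n) (Algebra.TensorProduct.basis R (ratBasis M))).comp (blockGLV (R ⊗[ℚ] M)))

/-- **The Gram matrix of `ψ_{V,R}` in the basis `eᵢ ⊗ (1 ⊗ b_k)` is the base change of the Gram matrix of `ψ_V`.** [cite: Milne2005ShimuraVarieties, §8 p. 81] -/
theorem traceGramV_baseChange :
    traceGram (m := Fin n) (conjR M R) (auxGramVR M j H ξ R) (Algebra.TensorProduct.basis R (ratBasis M)) =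
      (traceGram (m := Fin n) (conjAlgHom M) (auxGramV M j H ξ) (ratBasis M)).map (algebraMap ℚ R) := by
  ext p q
  rw [Matrix.map_apply, traceGram_apply, traceGram_apply, Algebra.TensorProduct.basis_apply, Algebra.TensorProduct.basis_apply, conjR_tmul,
    auxGramVR_apply, Algebra.TensorProduct.tmul_mul_tmul, Algebra.TensorProduct.tmul_mul_tmul, one_mul, one_mul, trace_one_tmul, conjAlgHom_apply]

/-- `ᵗP·E·P` entrywise as a double contraction of columns. [cite: Milne2005ShimuraVarieties, §6 p. 67] -/
private theorem transpose_mul_mul_apply {m m' : Type} [Fintype m] [Fintype m'] {A : Type} [CommRing A] (P : Matrix m m' A) (E : Matrix m m A)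
    (p q : m') : (Pᵀ * E * P) p q = (fun a => P a p) ⬝ᵥ (E *ᵥ fun b => P b q) := by
  simp only [Matrix.mul_apply, Matrix.transpose_apply, dotProduct, Matrix.mulVec, Finset.sum_mul, Finset.mul_sum, mul_assoc]
  exact Finset.sum_comm

/-- **The Gram matrix of `ψ_V` in the `M`-adapted basis is `ᵗP·E_δ·P`** (the frame condition read on basis vectors). [cite: Milne2005ShimuraVarieties, §6 p. 67] -/
theorem traceGramV_eq_frame (F : SymplecticFrameV M j H ξ g δ) :
    traceGram (m := Fin n) (conjAlgHom M) (auxGramV M j H ξ) (ratBasis M) = (framePV F)ᵀ * typeFormOver δ ℚ * framePV F := by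
  ext p q
  rw [transpose_mul_mul_apply, traceGram, LinearMap.BilinForm.toMatrix_apply]
  change auxFormV M j H ξ _ _ = _
  rw [F.gram]
  congr 1
  · funext a; rw [framePV_apply]
  · congr 1; funext b; rw [framePV_apply]

/-- The Gram matrix of `ψ_{V,R}` is `ᵗP_R·E_δ·P_R`. [cite: Milne2005ShimuraVarieties, §6 p. 67] -/
theorem traceGramV_baseChange_eq_frame (F : SymplecticFrameV M j H ξ g δ) :
    traceGram (m := Fin n) (conjR M R) (auxGramVR M j H ξ R) (Algebra.TensorProduct.basis R (ratBasis M)) =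
      (framePVR R F)ᵀ * typeFormOver δ R * framePVR R F := by
  rw [traceGramV_baseChange, traceGramV_eq_frame F, Matrix.map_mul, Matrix.map_mul, Matrix.transpose_map, typeFormOver_map]
  rfl

/-- **`auxRepV` lands in `GSp_δ(R)`**: for `t ∈ (R ⊗ M)ˣ` with `c(t)·t = ν ∈ Rˣ` (the similitude torus `T₀ = Z^ℚ`) and `X ∈ GL_n(R ⊗ M)` unitary for `H^j`
(`ᵗc(X)·H^j·X = H^j`), `auxRepV R F (t, X)` is a symplectic similitude of `E_δ` with multiplier `ν`.
[cite: RapoportSmithlingZhang2020Diagonal, Remark 3.2 (ii)(iii) pp. 9–10] [cite: Milne2005ShimuraVarieties, §6 p. 67, §8 p. 81] -/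
theorem isMultiplier_auxRepV (F : SymplecticFrameV M j H ξ g δ) {t : (R ⊗[ℚ] M)ˣ} {X : GL (Fin n) (R ⊗[ℚ] M)} {ν : Rˣ}
    (ht : conjR M R (t : R ⊗[ℚ] M) * (t : R ⊗[ℚ] M) = algebraMap R (R ⊗[ℚ] M) (ν : R))
    (hX : ((X : Matrix (Fin n) (Fin n) (R ⊗[ℚ] M)).map (conjR M R))ᵀ *
        (H.map j).map (Algebra.TensorProduct.includeRight : M →ₐ[ℚ] R ⊗[ℚ] M) * (X : Matrix (Fin n) (Fin n) (R ⊗[ℚ] M)) =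
      (H.map j).map (Algebra.TensorProduct.includeRight : M →ₐ[ℚ] R ⊗[ℚ] M)) :
    IsMultiplier (typeFormOver δ R) (auxRepV R F (t, X)) ν := by
  have hG : auxGramVR M j H ξ R = ((1 : R) ⊗ₜ[ℚ] ξ) • (H.map j).map (Algebra.TensorProduct.includeRight : M →ₐ[ℚ] R ⊗[ℚ] M) := by
    rw [auxGramVR, auxGramV, map_smul_eq M (Algebra.TensorProduct.includeRight : M →ₐ[ℚ] R ⊗[ℚ] M) (map_mul _)]
    rfl
  have hform := block_formV (R ⊗[ℚ] M) (conjR M R) ((H.map j).map (Algebra.TensorProduct.includeRight : M →ₐ[ℚ] R ⊗[ℚ] M)) ((1 : R) ⊗ₜ ξ) ht hX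
  rw [← hG] at hform
  have hres := isMultiplier_resGL (m := Fin n) (conjR M R) (auxGramVR M j H ξ R) (Algebra.TensorProduct.basis R (ratBasis M))
    (A := blockGLV (R ⊗[ℚ] M) (t, X)) (ν := ν) hform
  rw [traceGramV_baseChange_eq_frame R F] at hres
  exact isMultiplier_conjRect (framePVR R F) (frameQVR R F) (framePVR_mul_frameQVR R F) (frameQVR_mul_framePVR R F) hres

/-- `auxRepV R F (t, X) ∈ GSp_δ(R)` under the torus and unitary conditions. [cite: RapoportSmithlingZhang2020Diagonal, Remark 3.2 (ii)(iii) pp. 9–10] -/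
theorem auxRepV_mem_similitudeGroupOfForm (F : SymplecticFrameV M j H ξ g δ) {t : (R ⊗[ℚ] M)ˣ} {X : GL (Fin n) (R ⊗[ℚ] M)}
    (ht : ∃ ν : Rˣ, conjR M R (t : R ⊗[ℚ] M) * (t : R ⊗[ℚ] M) = algebraMap R (R ⊗[ℚ] M) (ν : R))
    (hX : ((X : Matrix (Fin n) (Fin n) (R ⊗[ℚ] M)).map (conjR M R))ᵀ *
        (H.map j).map (Algebra.TensorProduct.includeRight : M →ₐ[ℚ] R ⊗[ℚ] M) * (X : Matrix (Fin n) (Fin n) (R ⊗[ℚ] M)) =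
      (H.map j).map (Algebra.TensorProduct.includeRight : M →ₐ[ℚ] R ⊗[ℚ] M)) :
    auxRepV R F (t, X) ∈ similitudeGroupOfForm (typeFormOver δ R) := by
  obtain ⟨ν, hν⟩ := ht
  exact ⟨ν, isMultiplier_auxRepV R F hν hX⟩

end Frame

end AuxV

end UnitaryCurve

end Literature.AlgebraicGeometry.ShimuraVarieties

end
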